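import Literature.NumberTheory.EllipticCurves.GenericFibreOpenImmersion
import Literature.AlgebraicGeometry.Motives.RatFnEverywhereUnitConstant
import Literature.AlgebraicGeometry.Morphisms.GlobalSectionsProperWithSection
import HarnessLib

/-!
# Rational functions that are units on the generic fibre of a proper `R`-scheme are constant there (road W, (W0) L4c′)

Topic `Literature/AlgebraicGeometry/Motives`, namespace `Literature.AlgebraicGeometry.Motives.RatFn`.  THEOREMS ONLY.
Cell `hodgecm-mathlib` (D-0151), fan B-III (T1) road W, sub-line `koizumi_strictly_local`, node (W0), leaf L4c′
(the shear identity `Φ^*(pr₂^*θ) = pr₂^*θ`), the «CONSTANCY + EVALUATION» half (B-p12; the «unit at every point of the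
generic fibre» half is B-p01's): let `R` be a discrete valuation ring with fraction field `K`, `𝒴 → Spec R` with integral
total space and universally closed (e.g. proper) structure morphism, and suppose the generic fibre has a `K`-point
`s : Spec K → 𝒴` (`s ≫ 𝒴.hom = Spec K → Spec R`).  A rational function `h ∈ K(𝒴)` which is a UNIT at every point of the
generic fibre `U₀ = 𝒴 ×_R Spec K ⊆ 𝒴` and whose germ at SOME point of `U₀` has residue `1` is the constant `1`
(`eq_one_of_forall_isUnitAt_genericFibre_of_residue_eq_one`).

Proof: transport to the open subscheme `U₀`, a `K`-scheme that is universally closed (base change of `𝒴 → Spec R` along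
the open generic point, ★ `exists_iso_pullback_specGenericPoint_opens`), integral, with the section induced by `s`; there
`Γ(U₀, 𝒪) = K` (Lβ ★ `Morphisms.bijective_algebraMapΓ_of_universallyClosed_of_section`, A-p04) and the constancy /
evaluation lemma Lγ (★ `RatFn.eq_one_of_forall_isUnitAt_of_residue_eq_one`, B-p20) applies to `h|_{U₀}`; finally
`K(𝒴) → K(U₀)` is injective.  Banked leaf toward road W (r₀); no floor change.

## References
* R. Hartshorne, *Algebraic Geometry*, GTM 52 (1977), I Thm. 3.4 (a), II Ex. 4.5 (d). [Hartshorne1977]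
* U. Görtz, T. Wedhorn, *Algebraic Geometry I*, 2nd ed. (2020), Prop. 3.29. [GortzWedhorn2020]
* S. Bosch, W. Lütkebohmert, M. Raynaud, *Néron Models* (1990), §4.2 (invariant differentials: «`φ^*ω = ω`»).
  [BLRNeronModels1990]
-/

noncomputable section

universe u

open CategoryTheory CategoryTheory.Limits AlgebraicGeometry TopologicalSpace

namespace Literature.AlgebraicGeometry.Motives

namespace RatFn

open Literature.NumberTheory.EllipticCurves Literature.AlgebraicGeometry.Morphisms

variable {R : Type u} [CommRing R] [IsDomain R] [IsDiscreteValuationRing R] {K : Type u} [Field K]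
  [Algebra R K] [IsFractionRing R K]
  (𝒴 : Over (Spec (.of R))) [IsIntegral 𝒴.left] [UniversallyClosed 𝒴.hom]

/-- **Constancy + evaluation on the generic fibre** (W0-SPEC Lβ + Lγ, run on the open subscheme `U₀ = 𝒴 ×_R Spec K`):
for `𝒴 → Spec R` universally closed with integral total space and a `K`-point `s` of the generic fibre, a rational function
`h ∈ K(𝒴)` which is a unit at every point of the generic fibre and whose germ `t` at some point `z` of the generic fibre has
residue `1` equals `1`. [cite: Hartshorne1977, I Thm. 3.4 (a) and II Ex. 4.5 (d)] [cite: GortzWedhorn2020, Prop. 3.29 (3)] -/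
theorem eq_one_of_forall_isUnitAt_genericFibre_of_residue_eq_one
    (s : Spec (.of K) ⟶ 𝒴.left) (hs : s ≫ 𝒴.hom = specGenericPoint R K) (h : 𝒴.left.functionField)
    (hh : ∀ q : 𝒴.left, 𝒴.hom.base q ∈ Set.range (specGenericPoint R K).base → IsUnitAt q h)
    {z : 𝒴.left} (hz : 𝒴.hom.base z ∈ Set.range (specGenericPoint R K).base)
    {t : 𝒴.left.presheaf.stalk z} (ht : toFunctionField z t = h)
    (h1 : IsLocalRing.residue (𝒴.left.presheaf.stalk z) t = 1) : h = 1 := by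
  haveI := isOpenImmersion_specGenericPoint R K
  -- the generic fibre as an open subscheme `U₀ ⊆ 𝒴`
  let U₀ : 𝒴.left.Opens := 𝒴.hom ⁻¹ᵁ (specGenericPoint R K).opensRange
  have hmem : ∀ q : 𝒴.left, 𝒴.hom.base q ∈ Set.range (specGenericPoint R K).base ↔ q ∈ U₀ := fun q => Iff.rfl
  have hzU : z ∈ U₀ := (hmem z).mp hz
  haveI : Nonempty U₀ := ⟨⟨z, hzU⟩⟩
  -- `U₀ ≅ 𝒴 ×_R Spec K` is universally closed over `Spec K`
  obtain ⟨e, he⟩ := exists_iso_pullback_specGenericPoint_opens R K 𝒴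
  let f : (U₀ : Scheme.{u}) ⟶ Spec (.of K) := e.inv ≫ pullback.snd 𝒴.hom (specGenericPoint R K)
  haveI : UniversallyClosed f := inferInstance
  letI : (U₀ : Scheme.{u}).Over (Spec (.of K)) := ⟨f⟩
  have hf : f ≫ specGenericPoint R K = U₀.ι ≫ 𝒴.hom := by
    change (e.inv ≫ pullback.snd 𝒴.hom (specGenericPoint R K)) ≫ _ = _
    rw [Category.assoc, ← pullback.condition, ← Category.assoc, ← he, Iso.inv_hom_id_assoc]
  -- the section of `U₀ → Spec K` induced by `s`
  have hsr : Set.range s.base ⊆ Set.range U₀.ι.base := by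
    rw [Scheme.Opens.range_ι]
    rintro _ ⟨p, rfl⟩
    change (s ≫ 𝒴.hom).base p ∈ (specGenericPoint R K).opensRange
    rw [hs]
    exact ⟨p, rfl⟩
  let σ : Spec (.of K) ⟶ (U₀ : Scheme.{u}) := IsOpenImmersion.lift U₀.ι s hsr
  have hσι : σ ≫ U₀.ι = s := IsOpenImmersion.lift_fac U₀.ι s hsr
  have hσ : σ ≫ f = 𝟙 _ := by
    rw [← cancel_mono (specGenericPoint R K), Category.assoc, hf, ← Category.assoc, hσι, hs,
      Category.id_comp]
  -- `Γ(U₀, 𝒪) = K`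
  have hΓ : Function.Surjective (algebraMapΓ ((U₀ : Scheme.{u}) ↘ Spec (.of K))) :=
    (bijective_algebraMapΓ_of_universallyClosed_of_section f σ hσ).2
  -- transport `h` to `K(U₀)`
  haveI : IsDominant U₀.ι := AlgebraicGeometry.Opens.isDominant_ι (U₀.2.dense ⟨z, hzU⟩)
  let h' : (U₀ : Scheme.{u}).functionField := functionFieldMap U₀.ι h
  have hh' : ∀ x : (U₀ : Scheme.{u}), IsUnitAt x h' := fun x =>
    (hh (U₀.ι.base x) ((hmem _).mpr x.2)).functionFieldMap
  let z' : (U₀ : Scheme.{u}) := ⟨z, hzU⟩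
  let t' : (U₀ : Scheme.{u}).presheaf.stalk z' := U₀.ι.stalkMap z' t
  have ht' : toFunctionField z' t' = h' := by
    show toFunctionField z' t' = functionFieldMap U₀.ι h
    rw [← ht]
    exact (functionFieldMap_toFunctionField U₀.ι z' t).symm
  have h1z : IsLocalRing.residue (𝒴.left.presheaf.stalk (U₀.ι.base z')) t = 1 := h1
  have h1' : IsLocalRing.residue _ t' = 1 := by
    change IsLocalRing.residue _ ((U₀.ι.stalkMap z').hom t) = 1
    rw [← IsLocalRing.ResidueField.map_residue, h1z, map_one]
  have key : h' = 1 := eq_one_of_forall_isUnitAt_of_residue_eq_one hΓ h' hh' ht' h1'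
  -- `K(𝒴) → K(U₀)` is injective
  exact (functionFieldMap U₀.ι).injective (by rw [map_one]; exact key)

end RatFn

end Literature.AlgebraicGeometry.Motives

end
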